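import Literature.AlgebraicGeometry.HodgeTheory.ComplexOrientationFamily
import Literature.AlgebraicGeometry.HodgeTheory.TopDegreeClasses
import Literature.AlgebraicTopology.SingularHomology.HomologyRingChange
import Literature.Geometry.Manifold.DeRhamFundamentalClassPairing
import HarnessLib

/-!
# Automorphisms of odd order preserve the real fundamental class (leaf A0 of crux I)
(cell `hodge-kum4`, seat p2)

HONEST FRAMING.  PROVED from the tree: for `X` smooth projective of dimension `n`, `μ` ANY integral
orientation of the closed connected manifold `X(ℂ)` and `[X]_ℝ = [X(ℂ)]_μ ⊗ 1 ∈ H_{2n}(X(ℂ); ℝ)`: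

* `exists_map_realFundamentalClass_eq_smul` — every automorphism `g` of `X` acts on the line
  `H_{2n}(X(ℂ); ℝ) = ℝ · [X]_ℝ` by a scalar `r(g)` (`exists_eq_smul_coeffChange_fundamentalClass`);
* the scalar is multiplicative and `r(1) = 1` (functoriality of `g ↦ g(ℂ)_*`);
* `map_realFundamentalClass_eq_self_of_odd_card` — hence for `g` in a subgroup `G ≤ Aut X` of ODD
  order, `r(g)^{|G|} = r(g^{|G|}) = 1` forces `r(g) = 1` (odd powers are injective on `ℝ`):
  `g(ℂ)_*[X]_ℝ = [X]_ℝ`.  For a `Kum⁴`-type `X` and `G = Γ(X)` of order `625` this is the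
  hypothesis `hμΓ` ("`Γ` preserves the orientation class") of the `G`-signature bookkeeping — obtained
  WITHOUT identifying the sign of `g(ℂ)_*` on `[X(ℂ)]` for a general automorphism.
-/

noncomputable section

open CategoryTheory
open Literature.AlgebraicTopology.SingularHomology
open Literature.AlgebraicGeometry Literature.AlgebraicGeometry.HodgeTheory
open Literature.Geometry.Manifold

namespace Summit.Ventures.HodgeKum4

variable {n : ℕ} {X : Motives.SchemeOver ℂ}

/-- Every automorphism acts on the top real homology line by a scalar:
`g(ℂ)_*[X]_ℝ = r • [X]_ℝ`. -/
theorem exists_map_realFundamentalClass_eq_smul (hX : Motives.IsSmoothProjective n X)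
    (μ : HomologicalOrientation ℤ (Motives.ComplexPoints X) (2 * n)) (g : X ⟶ X) :
    ∃ r : ℝ, singularHomology.map ℝ ℝ (Motives.AlgPoints.mapContinuous (L := ℂ) g) (2 * n)
        (singularHomology.coeffChange (Motives.ComplexPoints X)
          (algebraMap ℤ ℝ : ℤ →+* ℝ).toAddMonoidHom (2 * n) μ.fundamentalClass) =
      r • singularHomology.coeffChange (Motives.ComplexPoints X)
          (algebraMap ℤ ℝ : ℤ →+* ℝ).toAddMonoidHom (2 * n) μ.fundamentalClass := by
  letI := hX.chartedSpace
  haveI := Motives.ComplexPoints.compactSpace_of_isSmoothProjective hX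
  haveI := Motives.ComplexPoints.t2Space_of_isSmoothProjective hX
  haveI := connectedSpace_complexPoints hX
  exact exists_eq_smul_coeffChange_fundamentalClass ℝ μ _

/-- **Automorphisms in a subgroup of odd order preserve `[X]_ℝ`**: for `G ≤ Aut X` with `|G|` odd
and `g ∈ G`, `g(ℂ)_*[X]_ℝ = [X]_ℝ`. -/
theorem map_realFundamentalClass_eq_self_of_odd_card (hX : Motives.IsSmoothProjective n X)
    (μ : HomologicalOrientation ℤ (Motives.ComplexPoints X) (2 * n)) (G : Subgroup (Aut X))
    (hG : Odd (Nat.card G)) (g : Aut X) (hg : g ∈ G) :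
    singularHomology.map ℝ ℝ (Motives.AlgPoints.mapContinuous (L := ℂ) g.hom) (2 * n)
        (singularHomology.coeffChange (Motives.ComplexPoints X)
          (algebraMap ℤ ℝ : ℤ →+* ℝ).toAddMonoidHom (2 * n) μ.fundamentalClass) =
      singularHomology.coeffChange (Motives.ComplexPoints X)
          (algebraMap ℤ ℝ : ℤ →+* ℝ).toAddMonoidHom (2 * n) μ.fundamentalClass := by
  letI := hX.chartedSpace
  haveI := Motives.ComplexPoints.compactSpace_of_isSmoothProjective hX
  haveI := Motives.ComplexPoints.t2Space_of_isSmoothProjective hX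
  haveI := connectedSpace_complexPoints hX
  set c := singularHomology.coeffChange (Motives.ComplexPoints X)
    (algebraMap ℤ ℝ : ℤ →+* ℝ).toAddMonoidHom (2 * n) μ.fundamentalClass with hc
  have hc0 : c ≠ 0 := coeffChange_fundamentalClass_ne_zero ℝ μ
  -- the scalar `r(g)` of each automorphism
  choose r hr using fun g : Aut X ↦ exists_map_realFundamentalClass_eq_smul hX μ g.hom
  -- multiplicativity `r(g * h) = r(h) * r(g)` and `r(1) = 1`
  have hmul : ∀ g h : Aut X, r (g * h) = r h * r g := by
    intro g h
    apply smul_left_injective ℝ hc0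
    change r (g * h) • c = (r h * r g) • c
    rw [← hr (g * h), show (g * h).hom = h.hom ≫ g.hom from rfl,
      Motives.AlgPoints.mapContinuous_comp, singularHomology.map_comp, ModuleCat.comp_apply,
      hr h, map_smul, hr g, smul_smul]
  have hone : r 1 = 1 := by
    apply smul_left_injective ℝ hc0
    change r 1 • c = (1 : ℝ) • c
    rw [← hr 1, one_smul, show (1 : Aut X).hom = 𝟙 X from rfl, Motives.AlgPoints.mapContinuous_id,
      singularHomology.map_id]
    rfl
  have hpow : ∀ (g : Aut X) (k : ℕ), r (g ^ k) = r g ^ k := by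
    intro g k
    induction k with
    | zero => rw [pow_zero, pow_zero, hone]
    | succ k ih => rw [pow_succ, hmul, ih, pow_succ, mul_comm]
  -- `g ^ |G| = 1` in `G`, so `r(g) ^ |G| = 1`, and `|G|` is odd
  have hgpow : g ^ Nat.card G = 1 := by
    have h := pow_card_eq_one' (G := G) (x := ⟨g, hg⟩)
    exact congrArg Subtype.val h
  have hr1 : r g ^ Nat.card G = 1 := by rw [← hpow, hgpow, hone]
  have hrg : r g = 1 := by
    apply (Odd.strictMono_pow (R := ℝ) hG).injective
    change r g ^ Nat.card G = 1 ^ Nat.card G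
    rw [hr1, one_pow]
  rw [hr g, hrg, one_smul]

end Summit.Ventures.HodgeKum4

end
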